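import Literature.NumberTheory.Transcendental.KZDirichletCharts
import Literature.NumberTheory.Transcendental.KZMellinFibres

/-!
# `BetaProductSector` (stmt-KontsevichZagierPeriods-3898), line `registered` (v3) — stub `stub_ddStep`,
# part 1: the two elementary polynomial charts of the two-duplication move DD

The reflection-free TWO-DUPLICATION MOVE "DD" of the line,

  `B(c+½-d, 2c+2d) · B(c, d) = 4^d · B(2c, c+d+½) · B(c+½-d, d)`   (`0 < d < c + ½`),

(Legendre's duplication at `c+d` against Legendre's duplication at `c`, Andrews–Askey–Roy 1999 Thm 1.5.1) is
realised inside the Kontsevich–Zagier calculus of moves (Kontsevich–Zagier 2001 §1.2, rules (1), (2)) through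
a common parameter surface `P = {(w,v) | 0 < w, w(1+w) < v(1-v)}` (the pairs `(-w, v)` of a negative and a
positive root of the quartic `X²(1-X)² = F·X + F·G/4` attached to a point of either box). This first part
supplies the two ELEMENTARY polynomial charts of the chain, in the format of `KZ.exists_dirichletPolarChart`:

* `DdStep.exists_chartChi`: `χ(x,σ) = (σ, xσ)` carries the open simplex `{x>0, σ>0, x+σ<1}` onto the lens
  `T = {(σ,g) | 0 < g < σ(1-σ)}`, `|det Dχ| = σ`;
* `DdStep.exists_chartRho`: `ρ(x,y) = (1-x, y·x²(1-x))` carries the open box `(0,1)²` onto the region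
  `M = {(v,φ) | 0<v<1, 0 < φ < v(1-v)²}`, `|det Dρ| = x²(1-x)`;

together with the `ℚ`-semialgebraicity of `T`, `M` and `P`. Everything is proved; no `def`, no named fact.
-/

noncomputable section

open MeasureTheory Set
open Literature.ModelTheory.ExponentialFields (IsSemialgebraic)

namespace Summit.KontsevichZagierPeriods.FermatIsogeny.BetaProductSectorStubs

open Literature.NumberTheory.Transcendental
open Literature.NumberTheory.Transcendental.KZ

namespace DdStep

/-! ## The regions -/

/-- The lens `T = {(σ,g) | 0 < g < σ(1-σ)}` is `ℚ`-semialgebraic. [folklore] -/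
theorem isSemialgebraic_lens :
    IsSemialgebraic ℚ {z : Fin 2 → ℝ | 0 < z 1 ∧ z 1 < z 0 * (1 - z 0)} := by
  have h := KZ.isSemialgebraic_setOf_forall_aeval_pos
    ![(MvPolynomial.X 1 : MvPolynomial (Fin 2) ℚ), MvPolynomial.X 0 * (1 - MvPolynomial.X 0) - MvPolynomial.X 1]
  convert h using 1
  ext z
  simp only [mem_setOf_eq, Fin.forall_fin_two, Matrix.cons_val_zero, Matrix.cons_val_one, map_sub, map_mul,
    map_one, MvPolynomial.aeval_X, sub_pos]

/-- The region `M = {(v,φ) | 0 < v < 1, 0 < φ < v(1-v)²}` is `ℚ`-semialgebraic. [folklore] -/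
theorem isSemialgebraic_regionM :
    IsSemialgebraic ℚ {z : Fin 2 → ℝ | 0 < z 0 ∧ z 0 < 1 ∧ 0 < z 1 ∧ z 1 < z 0 * (1 - z 0) ^ 2} := by
  have h := KZ.isSemialgebraic_setOf_forall_aeval_pos
    ![(MvPolynomial.X 0 : MvPolynomial (Fin 2) ℚ), 1 - MvPolynomial.X 0, MvPolynomial.X 1,
      MvPolynomial.X 0 * (1 - MvPolynomial.X 0) ^ 2 - MvPolynomial.X 1]
  convert h using 1
  ext z
  simp only [mem_setOf_eq, Fin.forall_fin_succ, IsEmpty.forall_iff, Matrix.cons_val_zero,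
    Matrix.cons_val_succ, map_sub, map_mul, map_pow, map_one, MvPolynomial.aeval_X, sub_pos, and_true]

/-- The parameter surface `P = {(w,v) | 0 < w, w(1+w) < v(1-v)}` of the two-duplication move is
`ℚ`-semialgebraic. [folklore] -/
theorem isSemialgebraic_regionP :
    IsSemialgebraic ℚ {z : Fin 2 → ℝ | 0 < z 0 ∧ z 0 * (1 + z 0) < z 1 * (1 - z 1)} := by
  have h := KZ.isSemialgebraic_setOf_forall_aeval_pos
    ![(MvPolynomial.X 0 : MvPolynomial (Fin 2) ℚ),
      MvPolynomial.X 1 * (1 - MvPolynomial.X 1) - MvPolynomial.X 0 * (1 + MvPolynomial.X 0)]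
  convert h using 1
  ext z
  simp only [mem_setOf_eq, Fin.forall_fin_two, Matrix.cons_val_zero, Matrix.cons_val_one, map_sub, map_mul,
    map_add, map_one, MvPolynomial.aeval_X, sub_pos]

/-! ## The chart `χ(x,σ) = (σ, xσ)` of the lens by the simplex -/

/-- **The chart `χ(x,σ) = (σ, xσ)`** of the lens `T = {0 < g < σ(1-σ)}` by the open simplex
`{x > 0, σ > 0, x + σ < 1}`: a `ℚ`-polynomial map, differentiable with `|det Dχ| = σ`, injective on the
simplex and ONTO the lens (inverse `x = g/σ`, `σ = σ`). [folklore] -/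
theorem exists_chartChi :
    ∃ (Φ : (Fin 2 → ℝ) → (Fin 2 → ℝ)) (Φ' : (Fin 2 → ℝ) → (Fin 2 → ℝ) →L[ℝ] (Fin 2 → ℝ)),
      (∀ z, Φ z 0 = z 1) ∧ (∀ z, Φ z 1 = z 0 * z 1) ∧
      IsSemialgebraicMapOn ℚ {z : Fin 2 → ℝ | 0 < z 0 ∧ 0 < z 1 ∧ z 0 + z 1 < 1} Φ ∧
      (∀ z, HasFDerivAt Φ (Φ' z) z) ∧
      Set.InjOn Φ {z : Fin 2 → ℝ | 0 < z 0 ∧ 0 < z 1 ∧ z 0 + z 1 < 1} ∧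
      Φ '' {z : Fin 2 → ℝ | 0 < z 0 ∧ 0 < z 1 ∧ z 0 + z 1 < 1} =
        {z : Fin 2 → ℝ | 0 < z 1 ∧ z 1 < z 0 * (1 - z 0)} ∧
      (∀ z ∈ {z : Fin 2 → ℝ | 0 < z 0 ∧ 0 < z 1 ∧ z 0 + z 1 < 1}, |(Φ' z).det| = z 1) := by
  set Φ : (Fin 2 → ℝ) → (Fin 2 → ℝ) := fun z => ![z 1, z 0 * z 1] with hΦ
  set Φ' : (Fin 2 → ℝ) → (Fin 2 → ℝ) →L[ℝ] (Fin 2 → ℝ) :=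
    fun z => LinearMap.toContinuousLinearMap (Matrix.toLin' !![0, 1; z 1, z 0]) with hΦ'
  have hΦ0 : ∀ z, Φ z 0 = z 1 := fun z => rfl
  have hΦ1 : ∀ z, Φ z 1 = z 0 * z 1 := fun z => rfl
  have hΦ'0 : ∀ z v : Fin 2 → ℝ, Φ' z v 0 = v 1 := by
    intro z v
    change Matrix.toLin' !![0, 1; z 1, z 0] v 0 = _
    rw [Matrix.toLin'_apply]
    simp [Matrix.mulVec, dotProduct, Fin.sum_univ_two]
  have hΦ'1 : ∀ z v : Fin 2 → ℝ, Φ' z v 1 = z 1 * v 0 + z 0 * v 1 := by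
    intro z v
    change Matrix.toLin' !![0, 1; z 1, z 0] v 1 = _
    rw [Matrix.toLin'_apply]
    simp [Matrix.mulVec, dotProduct, Fin.sum_univ_two]
  have hdet : ∀ z, (Φ' z).det = -(z 1) := by
    intro z
    change LinearMap.det (Matrix.toLin' !![0, 1; z 1, z 0]) = _
    rw [LinearMap.det_toLin', Matrix.det_fin_two]
    simp
  have hderiv : ∀ z, HasFDerivAt Φ (Φ' z) z := by
    intro z
    have h0 : HasFDerivAt (fun y : Fin 2 → ℝ => y 0)
        (ContinuousLinearMap.proj (R := ℝ) (φ := fun _ : Fin 2 => ℝ) 0) z := hasFDerivAt_apply 0 z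
    have h1 : HasFDerivAt (fun y : Fin 2 → ℝ => y 1)
        (ContinuousLinearMap.proj (R := ℝ) (φ := fun _ : Fin 2 => ℝ) 1) z := hasFDerivAt_apply 1 z
    rw [hasFDerivAt_pi']
    refine Fin.forall_fin_two.mpr ⟨?_, ?_⟩
    · have hf : (fun y : Fin 2 → ℝ => Φ y 0) = fun y => y 1 := funext fun y => rfl
      rw [hf]
      refine h1.congr_fderiv (ContinuousLinearMap.ext fun v => ?_)
      simp [hΦ'0]
    · have hf : (fun y : Fin 2 → ℝ => Φ y 1) = fun y => y 0 * y 1 := funext fun y => rfl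
      rw [hf]
      refine (h0.mul h1).congr_fderiv (ContinuousLinearMap.ext fun v => ?_)
      simp [hΦ'1]
      ring
  refine ⟨Φ, Φ', hΦ0, hΦ1, ?_, hderiv, ?_, ?_, fun z hz => ?_⟩
  · convert isSemialgebraicMapOn_aeval KZ.isSemialgebraic_simplex2
      ![MvPolynomial.X 1, MvPolynomial.X 0 * MvPolynomial.X 1] using 2 with z
    funext i
    fin_cases i
    · simp [hΦ0]
    · simp [hΦ1]
  · intro x hx y hy hxy
    have e0 := congrFun hxy 0
    have e1 := congrFun hxy 1
    simp only [hΦ0, hΦ1] at e0 e1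
    have h0 : x 0 = y 0 := by
      rw [e0] at e1
      exact mul_right_cancel₀ hy.2.1.ne' e1
    funext i
    fin_cases i
    · exact h0
    · exact e0
  · ext y
    constructor
    · rintro ⟨z, ⟨h0, h1, h2⟩, rfl⟩
      simp only [mem_setOf_eq, hΦ0, hΦ1]
      refine ⟨mul_pos h0 h1, ?_⟩
      nlinarith [mul_pos h1 (by linarith : 0 < 1 - z 0 - z 1)]
    · rintro ⟨hy1, hy2⟩
      have hy0 : 0 < y 0 := by nlinarith [sq_nonneg (y 0)]
      refine ⟨![y 1 / y 0, y 0], ⟨?_, ?_, ?_⟩, ?_⟩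
      · change 0 < y 1 / y 0
        exact div_pos hy1 hy0
      · change 0 < y 0
        exact hy0
      · change y 1 / y 0 + y 0 < 1
        rw [div_add' _ _ _ hy0.ne', div_lt_one hy0]
        nlinarith
      · funext i
        fin_cases i
        · rfl
        · change y 1 / y 0 * y 0 = y 1
          field_simp
  · rw [hdet, abs_neg, abs_of_pos hz.2.1]

/-! ## The chart `ρ(x,y) = (1-x, y·x²(1-x))` of the region `M` by the box -/

/-- **The chart `ρ(x,y) = (1-x, y·x²(1-x))`** of the region `M = {0<v<1, 0 < φ < v(1-v)²}` by the open box
`(0,1)²`: a `ℚ`-polynomial map, differentiable with `|det Dρ| = x²(1-x)`, injective on the box and ONTO `M`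
(inverse `x = 1-v`, `y = φ/(v(1-v)²)`). [folklore] -/
theorem exists_chartRho : ∃ (Φ : (Fin 2 → ℝ) → (Fin 2 → ℝ)) (Φ' : (Fin 2 → ℝ) → (Fin 2 → ℝ) →L[ℝ] (Fin 2 → ℝ)), (∀ z, Φ z 0 = 1 - z 0) ∧ (∀ z, Φ z 1 = z 1 * z 0 ^ 2 * (1 - z 0)) ∧ Literature.NumberTheory.Transcendental.IsSemialgebraicMapOn ℚ {z : Fin 2 → ℝ | z 0 ∈ Set.Ioo (0:ℝ) 1 ∧ z 1 ∈ Set.Ioo (0:ℝ) 1} Φ ∧ (∀ z, HasFDerivAt Φ (Φ' z) z) ∧ Set.InjOn Φ {z : Fin 2 → ℝ | z 0 ∈ Set.Ioo (0:ℝ) 1 ∧ z 1 ∈ Set.Ioo (0:ℝ) 1} ∧ Φ '' {z : Fin 2 → ℝ | z 0 ∈ Set.Ioo (0:ℝ) 1 ∧ z 1 ∈ Set.Ioo (0:ℝ) 1} = {z : Fin 2 → ℝ | 0 < z 0 ∧ z 0 < 1 ∧ 0 < z 1 ∧ z 1 < z 0 * (1 - z 0) ^ 2} ∧ (∀ z ∈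 {z : Fin 2 → ℝ | z 0 ∈ Set.Ioo (0:ℝ) 1 ∧ z 1 ∈ Set.Ioo (0:ℝ) 1}, |(Φ' z).det| = z 0 ^ 2 * (1 - z 0)) := by
  set Φ : (Fin 2 → ℝ) → (Fin 2 → ℝ) := fun z => ![1 - z 0, z 1 * z 0 ^ 2 * (1 - z 0)] with hΦ
  set Φ' : (Fin 2 → ℝ) → (Fin 2 → ℝ) →L[ℝ] (Fin 2 → ℝ) :=
    fun z => LinearMap.toContinuousLinearMap
      (Matrix.toLin' !![-1, 0; z 1 * (2 * z 0 - 3 * z 0 ^ 2), z 0 ^ 2 * (1 - z 0)]) with hΦ'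
  have hΦ0 : ∀ z, Φ z 0 = 1 - z 0 := fun z => rfl
  have hΦ1 : ∀ z, Φ z 1 = z 1 * z 0 ^ 2 * (1 - z 0) := fun z => rfl
  have hΦ'0 : ∀ z v : Fin 2 → ℝ, Φ' z v 0 = -(v 0) := by
    intro z v
    change Matrix.toLin' !![-1, 0; z 1 * (2 * z 0 - 3 * z 0 ^ 2), z 0 ^ 2 * (1 - z 0)] v 0 = _
    rw [Matrix.toLin'_apply]
    simp [Matrix.mulVec, dotProduct, Fin.sum_univ_two]
  have hΦ'1 : ∀ z v : Fin 2 → ℝ,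
      Φ' z v 1 = z 1 * (2 * z 0 - 3 * z 0 ^ 2) * v 0 + z 0 ^ 2 * (1 - z 0) * v 1 := by
    intro z v
    change Matrix.toLin' !![-1, 0; z 1 * (2 * z 0 - 3 * z 0 ^ 2), z 0 ^ 2 * (1 - z 0)] v 1 = _
    rw [Matrix.toLin'_apply]
    simp [Matrix.mulVec, dotProduct, Fin.sum_univ_two]
  have hdet : ∀ z, (Φ' z).det = -(z 0 ^ 2 * (1 - z 0)) := by
    intro z
    change LinearMap.det
      (Matrix.toLin' !![-1, 0; z 1 * (2 * z 0 - 3 * z 0 ^ 2), z 0 ^ 2 * (1 - z 0)]) = _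
    rw [LinearMap.det_toLin', Matrix.det_fin_two]
    simp
  have hderiv : ∀ z, HasFDerivAt Φ (Φ' z) z := by
    intro z
    have h0 : HasFDerivAt (fun y : Fin 2 → ℝ => y 0)
        (ContinuousLinearMap.proj (R := ℝ) (φ := fun _ : Fin 2 => ℝ) 0) z := hasFDerivAt_apply 0 z
    have h1 : HasFDerivAt (fun y : Fin 2 → ℝ => y 1)
        (ContinuousLinearMap.proj (R := ℝ) (φ := fun _ : Fin 2 => ℝ) 1) z := hasFDerivAt_apply 1 z
    rw [hasFDerivAt_pi']
    refine Fin.forall_fin_two.mpr ⟨?_, ?_⟩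
    · have hf : (fun y : Fin 2 → ℝ => Φ y 0) = fun y => 1 - y 0 := funext fun y => rfl
      rw [hf]
      refine (h0.const_sub 1).congr_fderiv (ContinuousLinearMap.ext fun v => ?_)
      simp [hΦ'0]
    · have hf : (fun y : Fin 2 → ℝ => Φ y 1) = fun y => y 1 * (y 0 * y 0) * (1 - y 0) :=
        funext fun y => by rw [hΦ1]; ring
      rw [hf]
      refine ((h1.mul (h0.mul h0)).mul (h0.const_sub 1)).congr_fderiv (ContinuousLinearMap.ext fun v => ?_)
      simp [hΦ'1]
      ring
  refine ⟨Φ, Φ', hΦ0, hΦ1, ?_, hderiv, ?_, ?_, fun z hz => ?_⟩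
  · convert isSemialgebraicMapOn_aeval KZ.isSemialgebraic_box2
      ![1 - MvPolynomial.X 0, MvPolynomial.X 1 * MvPolynomial.X 0 ^ 2 * (1 - MvPolynomial.X 0)] using 2 with z
    funext i
    fin_cases i
    · simp [hΦ0]
    · simp [hΦ1]
  · intro x hx y hy hxy
    have e0 := congrFun hxy 0
    have e1 := congrFun hxy 1
    simp only [hΦ0, hΦ1] at e0 e1
    have h0 : x 0 = y 0 := by linarith
    have hpos : 0 < y 0 ^ 2 * (1 - y 0) := mul_pos (pow_pos hy.1.1 2) (sub_pos.2 hy.1.2)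
    have h1 : x 1 = y 1 := by
      rw [h0, mul_assoc, mul_assoc] at e1
      exact mul_right_cancel₀ hpos.ne' e1
    funext i
    fin_cases i
    · exact h0
    · exact h1
  · ext y
    constructor
    · rintro ⟨z, ⟨h0, h1⟩, rfl⟩
      simp only [mem_setOf_eq, hΦ0, hΦ1]
      have hp : 0 < z 0 ^ 2 * (1 - z 0) := mul_pos (pow_pos h0.1 2) (sub_pos.2 h0.2)
      refine ⟨sub_pos.2 h0.2, by linarith [h0.1], by rw [mul_assoc]; exact mul_pos h1.1 hp, ?_⟩
      have e : (1 - z 0) * (1 - (1 - z 0)) ^ 2 = z 0 ^ 2 * (1 - z 0) := by ring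
      rw [e, mul_assoc]
      exact mul_lt_of_lt_one_left hp h1.2
    · rintro ⟨hy0, hy0', hy1, hy2⟩
      have hp : 0 < y 0 * (1 - y 0) ^ 2 := mul_pos hy0 (pow_pos (sub_pos.2 hy0') 2)
      refine ⟨![1 - y 0, y 1 / (y 0 * (1 - y 0) ^ 2)], ⟨?_, ?_⟩, ?_⟩
      · change 1 - y 0 ∈ Set.Ioo (0:ℝ) 1
        exact ⟨by linarith, by linarith⟩
      · change y 1 / (y 0 * (1 - y 0) ^ 2) ∈ Set.Ioo (0:ℝ) 1
        exact ⟨div_pos hy1 hp, by rwa [div_lt_one hp]⟩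
      · funext i
        fin_cases i
        · change 1 - (1 - y 0) = y 0
          ring
        · change y 1 / (y 0 * (1 - y 0) ^ 2) * (1 - y 0) ^ 2 * (1 - (1 - y 0)) = y 1
          have h1y : (1 - y 0) ≠ 0 := (sub_pos.2 hy0').ne'
          field_simp
          ring
  · rw [hdet, abs_neg, abs_of_pos (mul_pos (pow_pos hz.1.1 2) (sub_pos.2 hz.1.2))]

end DdStep

end Summit.KontsevichZagierPeriods.FermatIsogeny.BetaProductSectorStubs

end
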